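import Summits.CriticalPhenomena.Ising3DConformalLimit.Theorems.EnergyNotSigmaSquaredEnergyGapSoftRatioBounds
import Literature.Probability.LatticeModels.CriticalTwoPointLower

/-!
# `EnergyGapSoft` forces RATIO REGULARITY of the critical two-point function on `ℤ³`
(item stmt-CriticalPhenomena-4473, route `EnergyNotSigmaSquared`; sequel to
`EnergyNotSigmaSquaredEnergyGapSoftRatioBounds`, continued in `…ParMerging`)

Notation: `G = criticalTwoPoint 3`, `e₂ = Pi.single 1 1`, `β_c = criticalBeta 3`.

The previous file turned the second-ratio regularity forced by the item
(`secondRatioRegular_of_energyGapSoft`) into ratio regularity in direction `e₂`, `G(x+e₂)/G(x) → 1`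
(cofinite). Here:

* `ratioRegular_single_of_ratioRegular_e₂`, `ratioRegular_add`, `ratioRegular_neg`,
  `ratioRegular_zsmul`, `ratioRegular_all_of_ratioRegular_e₂` — by the coordinate-permutation symmetry
  of `⟨σ₀σ_x⟩⁺` (`twoPointPlus_perm_invariant_holds`) and the cocycle identity
  `G(x+u+v)/G(x) = G(x+u+v)/G(x+u) · G(x+u)/G(x)`, direction `e₂` gives every shift `u ∈ ℤ³`;
* **`ratioRegular_of_energyGapSoft`** — `EnergyGapSoft → ∀ u, ⟨σ₀σ_{x+u}⟩_{β_c}/⟨σ₀σ_x⟩_{β_c} → 1`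
  as `x → ∞`: any proof of item 4473 proves ratio regularity of the critical two-point function on
  `ℤ³`, the lattice statement recorded as OPEN in `MoebiusLimitExists/Negative/RatioRegular.lean`
  (there derived from the crux `MoebiusLimit`, `moebiusLimit_implies_ratio_regularity`, in the SAME
  form; along an axis it is the theorem `criticalTwoPoint_axis_ratio_tendsto_one`);
* `energyGapSoft_iff_parMerging_and_ratioRegular` — item ⟺ parallel adjacent merging ∧ `RR(e₂)`;
* `ratio_le_of_lowerSecondRatio_of_ceiling` — the ray argument of `ratio_le_of_secondRatioRegular`
  in sharp form, for an ABSTRACT positive lattice function `F` with a polynomial ray ceiling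
  `F(x+Ke) ≤ c⁻¹K²F(x)`: ASYMPTOTIC LOG-CONVEXITY `F(y+e)F(y-e) ≥ (1-η)F(y)²` alone (the lower half of
  second-ratio regularity) forces `F(x+e)/F(x) ≤ 1 + δ` eventually; for `F = G`:
  `ratio_le_of_lowerSecondRatio`, `ratio_near_one_of_lowerSecondRatio`, and
  **`ratioRegular_of_lowerSecondRatio_e₂`** — asymptotic log-convexity of `G` in direction `e₂` alone
  forces ratio regularity for every shift (used in `…ParMerging`: parallel merging supplies exactly
  this half).

Nothing here asserts the item.

## References

* M. Aizenman, H. Duminil-Copin, Ann. of Math. 194 (2021), §3.2 eq. (3.11), Remark 5.10, §5.6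
  [AizenmanDuminilCopinAnnals2021].
* S. Friedli, Y. Velenik, *Statistical Mechanics of Lattice Systems* (CUP 2017), Thm. 3.20,
  Exercise 3.14 [FriedliVelenik2017].
-/

noncomputable section

namespace Summit.CriticalPhenomena.Ising3DConformalLimit.EnergyNotSigmaSquaredEnergyGapSoft

open scoped symmDiff
open MeasureTheory Filter Topology
open Literature.Probability.LatticeModels Literature.Probability.Percolation
open Summit.CriticalPhenomena.Ising3DConformalLimit.Theses.EnergyNotSigmaSquared
open Summit.CriticalPhenomena.Ising3DConformalLimit.PinnedClusterPoints (criticalTwoPoint_pos3)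

/-! ### Transport to every shift -/

/-- Ratio regularity in direction `e₂` gives it in every axis direction `eᵢ`, by the coordinate
permutation symmetry of `⟨σ₀σ_x⟩⁺_{β_c}`. [cite: FriedliVelenik2017, Exercise 3.14, p. 115] -/
theorem ratioRegular_single_of_ratioRegular_e₂
    (h : Tendsto (fun x : Site 3 => criticalTwoPoint 3 (x + Pi.single 1 1) / criticalTwoPoint 3 x)
      cofinite (𝓝 1)) (i : Fin 3) :
    Tendsto (fun x : Site 3 => criticalTwoPoint 3 (x + Pi.single i 1) / criticalTwoPoint 3 x)
      cofinite (𝓝 1) := by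
  set π : Equiv.Perm (Fin 3) := Equiv.swap 1 i with hπ
  set φ : Site 3 → Site 3 := fun x k => x (π k) with hφ
  have hφinj : Function.Injective φ := fun x y hxy => by
    funext k
    have := congrFun hxy (π.symm k)
    simpa [hφ] using this
  have hG : ∀ y : Site 3, criticalTwoPoint 3 (φ y) = criticalTwoPoint 3 y := fun y =>
    twoPointPlus_perm_invariant_holds (d := 3) (criticalBeta_nonneg 3) π y
  have hφe : φ (Pi.single i 1) = Pi.single 1 1 := by
    funext k
    simp only [hφ]
    by_cases hk : k = 1
    · subst hk; simp [hπ]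
    · have hne : π k ≠ i := by
        intro hki
        apply hk
        have : k = π.symm i := by rw [← hki]; simp
        rw [this, hπ]; simp
      rw [Pi.single_eq_of_ne hne, Pi.single_eq_of_ne hk]
  have hφadd : ∀ x y : Site 3, φ (x + y) = φ x + φ y := fun x y => by funext k; simp [hφ]
  have heq : (fun x : Site 3 => criticalTwoPoint 3 (x + Pi.single i 1) / criticalTwoPoint 3 x) =
      (fun x : Site 3 => criticalTwoPoint 3 (x + Pi.single 1 1) / criticalTwoPoint 3 x) ∘ φ := by
    funext x
    simp only [Function.comp_apply]
    rw [← hG (x + Pi.single i 1), ← hG x, hφadd, hφe]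
  rw [heq]
  exact h.comp hφinj.tendsto_cofinite

/-- Ratio regularity is closed under addition of the shifts (cocycle identity). [folklore] -/
theorem ratioRegular_add {u v : Site 3}
    (hu : Tendsto (fun x : Site 3 => criticalTwoPoint 3 (x + u) / criticalTwoPoint 3 x) cofinite (𝓝 1))
    (hv : Tendsto (fun x : Site 3 => criticalTwoPoint 3 (x + v) / criticalTwoPoint 3 x) cofinite (𝓝 1)) :
    Tendsto (fun x : Site 3 => criticalTwoPoint 3 (x + (u + v)) / criticalTwoPoint 3 x) cofinite (𝓝 1) := by
  have hGpos : ∀ w, 0 < criticalTwoPoint 3 w := criticalTwoPoint_pos3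
  have heq : (fun x : Site 3 => criticalTwoPoint 3 (x + (u + v)) / criticalTwoPoint 3 x) =
      fun x => ((fun y : Site 3 => criticalTwoPoint 3 (y + v) / criticalTwoPoint 3 y) ∘ (· + u)) x *
        (criticalTwoPoint 3 (x + u) / criticalTwoPoint 3 x) := by
    funext x
    simp only [Function.comp_apply]
    rw [← add_assoc, div_mul_div_cancel₀ (hGpos _).ne']
  rw [heq, ← mul_one (1 : ℝ)]
  exact ((hv.comp (add_left_injective u).tendsto_cofinite).mul hu)

/-- Ratio regularity is closed under negation of the shift. [folklore] -/
theorem ratioRegular_neg {u : Site 3}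
    (hu : Tendsto (fun x : Site 3 => criticalTwoPoint 3 (x + u) / criticalTwoPoint 3 x) cofinite (𝓝 1)) :
    Tendsto (fun x : Site 3 => criticalTwoPoint 3 (x + -u) / criticalTwoPoint 3 x) cofinite (𝓝 1) := by
  have heq : (fun x : Site 3 => criticalTwoPoint 3 (x + -u) / criticalTwoPoint 3 x) =
      (fun y : Site 3 => (criticalTwoPoint 3 (y + u) / criticalTwoPoint 3 y)⁻¹) ∘ (· + -u) := by
    funext x
    simp only [Function.comp_apply]
    rw [inv_div, neg_add_cancel_right]
  rw [heq, ← inv_one]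
  exact (hu.inv₀ one_ne_zero).comp (add_left_injective (-u)).tendsto_cofinite

/-- Ratio regularity at the zero shift. [folklore] -/
theorem ratioRegular_zero :
    Tendsto (fun x : Site 3 => criticalTwoPoint 3 (x + 0) / criticalTwoPoint 3 x) cofinite (𝓝 1) := by
  have heq : (fun x : Site 3 => criticalTwoPoint 3 (x + 0) / criticalTwoPoint 3 x) = fun _ => 1 := by
    funext x; rw [add_zero, div_self (criticalTwoPoint_pos3 x).ne']
  rw [heq]; exact tendsto_const_nhds

/-- Ratio regularity for integer multiples of a regular shift. [folklore] -/
theorem ratioRegular_zsmul {u : Site 3}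
    (hu : Tendsto (fun x : Site 3 => criticalTwoPoint 3 (x + u) / criticalTwoPoint 3 x) cofinite (𝓝 1))
    (n : ℤ) :
    Tendsto (fun x : Site 3 => criticalTwoPoint 3 (x + n • u) / criticalTwoPoint 3 x) cofinite (𝓝 1) := by
  have hnat : ∀ m : ℕ,
      Tendsto (fun x : Site 3 => criticalTwoPoint 3 (x + m • u) / criticalTwoPoint 3 x) cofinite (𝓝 1) := by
    intro m
    induction m with
    | zero => simpa using ratioRegular_zero
    | succ m ih => rw [succ_nsmul]; exact ratioRegular_add ih hu
  cases n with
  | ofNat m => rw [Int.ofNat_eq_natCast, natCast_zsmul]; exact hnat m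
  | negSucc m => rw [negSucc_zsmul]; exact ratioRegular_neg (hnat (m + 1))

/-- **Ratio regularity in direction `e₂` gives ratio regularity for every shift `u ∈ ℤ³`.**
[cite: FriedliVelenik2017, Exercise 3.14, p. 115] -/
theorem ratioRegular_all_of_ratioRegular_e₂
    (h : Tendsto (fun x : Site 3 => criticalTwoPoint 3 (x + Pi.single 1 1) / criticalTwoPoint 3 x)
      cofinite (𝓝 1)) (u : Site 3) :
    Tendsto (fun x : Site 3 => criticalTwoPoint 3 (x + u) / criticalTwoPoint 3 x) cofinite (𝓝 1) := by
  have hsingle : ∀ i : Fin 3,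
      Tendsto (fun x : Site 3 => criticalTwoPoint 3 (x + (u i) • (Pi.single i 1 : Site 3)) /
        criticalTwoPoint 3 x) cofinite (𝓝 1) :=
    fun i => ratioRegular_zsmul (ratioRegular_single_of_ratioRegular_e₂ h i) (u i)
  have hdecomp : u = (u 0) • (Pi.single 0 1 : Site 3) + ((u 1) • (Pi.single 1 1 : Site 3) +
      (u 2) • (Pi.single 2 1 : Site 3)) := by
    funext k
    fin_cases k <;> simp
  rw [hdecomp]
  exact ratioRegular_add (hsingle 0) (ratioRegular_add (hsingle 1) (hsingle 2))

/-! ### The item -/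

/-- **`EnergyGapSoft` forces ratio regularity of `⟨σ₀σ_x⟩_{β_c}` on `ℤ³`:**
`⟨σ₀σ_{x+u}⟩_{β_c} / ⟨σ₀σ_x⟩_{β_c} → 1` as `x → ∞`, for every fixed lattice vector `u`. This is the
open lattice statement of `MoebiusLimitExists/Negative/RatioRegular.lean` (there a consequence of the
crux `MoebiusLimit`); so item 4473 is at least as hard as ratio regularity.
[cite: AizenmanDuminilCopinAnnals2021, eq. (3.11) and Remark 5.10] -/
theorem ratioRegular_of_energyGapSoft (h : EnergyGapSoft) (u : Site 3) :
    Tendsto (fun x : Site 3 => criticalTwoPoint 3 (x + u) / criticalTwoPoint 3 x) cofinite (𝓝 1) :=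
  ratioRegular_all_of_ratioRegular_e₂
    (ratioRegular_e₂_of_secondRatioRegular (secondRatioRegular_of_energyGapSoft h)) u

/-- Conversely, ratio regularity in direction `e₂` gives second-ratio regularity (`ε`-`R` form).
[folklore] -/
theorem secondRatioRegular_of_ratioRegular_e₂
    (h : Tendsto (fun x : Site 3 => criticalTwoPoint 3 (x + Pi.single 1 1) / criticalTwoPoint 3 x)
      cofinite (𝓝 1)) :
    ∀ ε : ℝ, 0 < ε → ∃ R : ℝ, ∀ x : Site 3, R ≤ ‖x‖ →
      |criticalTwoPoint 3 (x + Pi.single 1 1) * criticalTwoPoint 3 (x - Pi.single 1 1) /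
          criticalTwoPoint 3 x ^ 2 - 1| ≤ ε := by
  intro ε hε
  have h2 := ratioRegular_neg h
  have h3 := h.mul h2
  rw [mul_one] at h3
  have hev := (Metric.tendsto_nhds.1 h3) ε hε
  obtain ⟨R, hR⟩ := exists_radius_of_eventually_cofinite hev
  refine ⟨R, fun x hx => ?_⟩
  have h := (hR x hx).le
  rw [Real.dist_eq, ← sub_eq_add_neg, div_mul_div_comm, ← sq] at h
  exact h

/-- **`EnergyGapSoft` ⟺ parallel adjacent merging plus ratio regularity in direction `e₂`**: the item
holds iff the two critical sourced currents `0 → x`, `e₂ → x + e₂` merge with probability `→ 1` AND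
`⟨σ₀σ_{x+e₂}⟩_{β_c}/⟨σ₀σ_x⟩_{β_c} → 1` — two separate lattice statements, each open on `ℤ³`.
[cite: AizenmanDuminilCopinAnnals2021, eq. (3.11)] -/
theorem energyGapSoft_iff_parMerging_and_ratioRegular :
    EnergyGapSoft ↔
      (∀ ε : ℝ, 0 < ε → ∃ R : ℝ, ∀ x : Site 3, R ≤ ‖x‖ →
        1 - (sourcedDoubleCurrentLawInf 3 (criticalBeta 3) ({0} ∆ {x})
              ({(Pi.single 1 1 : Site 3)} ∆ {x + Pi.single 1 1})).real (openConn 0 (Pi.single 1 1)) ≤ ε) ∧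
      Tendsto (fun x : Site 3 => criticalTwoPoint 3 (x + Pi.single 1 1) / criticalTwoPoint 3 x)
        cofinite (𝓝 1) := by
  rw [energyGapSoft_iff_parMerging_and_secondRatioRegular]
  exact ⟨fun h => ⟨h.1, ratioRegular_e₂_of_secondRatioRegular h.2⟩,
    fun h => ⟨h.1, secondRatioRegular_of_ratioRegular_e₂ h.2⟩⟩

/-! ### The abstract ray argument -/

/-- **Asymptotic log-convexity along rays plus a polynomial ray ceiling force `F(x+e)/F(x) ≤ 1 + δ`
eventually**, for any positive lattice function `F` and unit lattice vector `e`: if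
`F(x + K e) ≤ c⁻¹ K² F(x)` for all `x` and `K ≥ 1`, and `F(y+e)F(y-e) ≥ (1-η)F(y)²` for `‖y‖ ≥ R(η)`,
then `F(x+e)/F(x) ≤ 1 + δ` for `‖x‖ ≥ R'(δ)`; otherwise `K` consecutive ratios along `x + ℕe` stay
`≥ 1 + δ/2` and `F(x+Ke) ≥ (1+δ/2)^K F(x)` beats the ceiling. [cite: AizenmanDuminilCopinAnnals2021, Remark 5.10] -/
theorem ratio_le_of_lowerSecondRatio_of_ceiling {F : Site 3 → ℝ} {e : Site 3} (he : ‖e‖ = 1)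
    (hF : ∀ v, 0 < F v) {c : ℝ} (hc : 0 < c)
    (hceil : ∀ K : ℕ, 1 ≤ K → ∀ x : Site 3, F (x + K • e) ≤ (K : ℝ) ^ 2 / c * F x)
    (hS : ∀ η : ℝ, 0 < η → ∃ R : ℝ, ∀ y : Site 3, R ≤ ‖y‖ → (1 - η) * F y ^ 2 ≤ F (y + e) * F (y - e))
    (δ : ℝ) (hδ : 0 < δ) :
    ∃ R : ℝ, ∀ x : Site 3, R ≤ ‖x‖ → F (x + e) / F x ≤ 1 + δ := by
  -- the growth factor `a` and the number of steps `K`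
  set a : ℝ := 1 + δ / 2 with ha_def
  have ha1 : 1 < a := by rw [ha_def]; linarith
  obtain ⟨K, hK1, hK⟩ := exists_nat_sq_div_lt_pow ha1 hc
  have hKpos : (0 : ℝ) < K := by exact_mod_cast hK1
  have hK1' : (1 : ℝ) ≤ K := by exact_mod_cast hK1
  -- the tolerance `η`, chosen with `(1 + δ)(1 - K η) = a`
  set η : ℝ := δ / (2 * K * (1 + δ)) with hη_def
  have hηpos : 0 < η := by rw [hη_def]; positivity
  have hKη : (1 + δ) * (1 - K * η) = a := by
    rw [hη_def, ha_def]; field_simp; ring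
  have hKη' : (K : ℝ) * η = δ / (2 * (1 + δ)) := by
    rw [hη_def]; field_simp
  have hKη_le : (K : ℝ) * η ≤ 1 / 2 := by
    rw [hKη', div_le_div_iff₀ (by positivity) (by norm_num)]
    linarith
  have hη1 : η ≤ 1 / 2 := by
    have : η ≤ K * η := le_mul_of_one_le_left hηpos.le hK1'
    linarith
  have h1η : 0 ≤ 1 - η := by linarith
  obtain ⟨R, hR⟩ := hS η hηpos
  refine ⟨R + K, fun x hx => ?_⟩
  by_contra hlt
  push Not at hlt
  -- consecutive ratios along the ray `x + ℕ e`
  set r : ℕ → ℝ := fun j => F (x + (j + 1) • e) / F (x + j • e) with hr_def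
  have hrpos : ∀ j, 0 < r j := fun j => div_pos (hF _) (hF _)
  have hfar : ∀ j : ℕ, j ≤ K → R ≤ ‖x + j • e‖ := by
    intro j hj
    have h := norm_sub_le_norm_add_nsmul he x j
    have hjK : (j : ℝ) ≤ K := by exact_mod_cast hj
    linarith
  -- (i) consecutive ratios shrink at most by the factor `1 - η`
  have hstep : ∀ j : ℕ, j + 1 ≤ K → (1 - η) * r j ≤ r (j + 1) := by
    intro j hj
    have hy := hR (x + (j + 1) • e) (hfar (j + 1) hj)
    have hsub : x + (j + 1) • e - e = x + j • e := by
      rw [succ_nsmul, ← add_assoc, add_sub_cancel_right]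
    have hadd : x + (j + 1) • e + e = x + (j + 1 + 1) • e := by
      rw [succ_nsmul e (j + 1), add_assoc]
    rw [hsub, hadd] at hy
    show (1 - η) * (F (x + (j + 1) • e) / F (x + j • e)) ≤ F (x + (j + 1 + 1) • e) / F (x + (j + 1) • e)
    rw [mul_div_assoc', div_le_div_iff₀ (hF _) (hF _)]
    nlinarith [hF (x + (j + 1) • e), hF (x + j • e)]
  -- (ii) hence they stay above `(1 + δ)(1 - η)^j ≥ a` for `K` steps
  have hdecay : ∀ j : ℕ, j + 1 ≤ K → (1 + δ) * (1 - η) ^ j ≤ r j := by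
    intro j
    induction j with
    | zero =>
      intro _
      have h0 : r 0 = F (x + e) / F x := by
        simp only [hr_def, zero_add, one_nsmul, zero_nsmul, add_zero]
      rw [pow_zero, mul_one, h0]
      exact hlt.le
    | succ j ih =>
      intro hj
      have ih' := ih (by omega)
      calc (1 + δ) * (1 - η) ^ (j + 1) = (1 - η) * ((1 + δ) * (1 - η) ^ j) := by ring
        _ ≤ (1 - η) * r j := mul_le_mul_of_nonneg_left ih' h1η
        _ ≤ r (j + 1) := hstep j (by omega)
  have hge : ∀ j : ℕ, j + 1 ≤ K → a ≤ r j := by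
    intro j hj
    have hbern : 1 + (K : ℝ) * (-η) ≤ (1 + (-η)) ^ K := one_add_mul_le_pow (by linarith) K
    have hpow : (1 - η) ^ K ≤ (1 - η) ^ j := pow_le_pow_of_le_one h1η (by linarith) (by omega)
    calc a = (1 + δ) * (1 - K * η) := hKη.symm
      _ ≤ (1 + δ) * (1 - η) ^ K := by
          apply mul_le_mul_of_nonneg_left _ (by linarith)
          have : (1 : ℝ) + K * -η = 1 - K * η := by ring
          have h2 : (1 : ℝ) + -η = 1 - η := by ring
          rw [this, h2] at hbern
          exact hbern
      _ ≤ (1 + δ) * (1 - η) ^ j := mul_le_mul_of_nonneg_left hpow (by linarith)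
      _ ≤ r j := hdecay j hj
  -- (iii) so `F` grows geometrically along the ray
  have hgrow : ∀ j : ℕ, j ≤ K → a ^ j * F x ≤ F (x + j • e) := by
    intro j
    induction j with
    | zero => intro _; simp
    | succ j ih =>
      intro hj
      have ih' := ih (by omega)
      have hrj := hge j hj
      have heq : F (x + (j + 1) • e) = r j * F (x + j • e) := by
        simp only [hr_def]
        rw [div_mul_cancel₀ _ (hF _).ne']
      rw [heq, pow_succ, show a ^ j * a * F x = a * (a ^ j * F x) by ring]
      exact mul_le_mul hrj ih' (mul_nonneg (pow_nonneg (by linarith) _) (hF x).le) (hrpos j).le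
  -- (iv) against the polynomial ceiling
  have htop := hgrow K le_rfl
  have hceilK := hceil K hK1 x
  have hFx := hF x
  have : a ^ K * F x ≤ (K : ℝ) ^ 2 / c * F x := htop.trans hceilK
  have hfin : a ^ K ≤ (K : ℝ) ^ 2 / c := le_of_mul_le_mul_right this hFx
  linarith

/-- Asymptotic log-convexity along rays is symmetric under `e ↦ -e`. [folklore] -/
theorem lowerSecondRatio_neg {F : Site 3 → ℝ} {e : Site 3}
    (hS : ∀ η : ℝ, 0 < η → ∃ R : ℝ, ∀ y : Site 3, R ≤ ‖y‖ → (1 - η) * F y ^ 2 ≤ F (y + e) * F (y - e)) :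
    ∀ η : ℝ, 0 < η → ∃ R : ℝ, ∀ y : Site 3, R ≤ ‖y‖ → (1 - η) * F y ^ 2 ≤ F (y + -e) * F (y - -e) := by
  intro η hη
  obtain ⟨R, hR⟩ := hS η hη
  refine ⟨R, fun y hy => ?_⟩
  rw [← sub_eq_add_neg, sub_neg_eq_add, mul_comm (F (y - e))]
  exact hR y hy

/-- The two one-sided bounds combine: if `F(x+e)/F(x) ≤ 1 + ε` beyond `R₁` and
`F(y+(-e))/F(y) ≤ 1 + ε` beyond `R₂` then `|F(x+e)/F(x) - 1| ≤ ε` beyond `max R₁ (R₂ + 1)`, for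
`F > 0` and a unit vector `e`. [folklore] -/
theorem ratio_near_one_of_two_sides {F : Site 3 → ℝ} {e : Site 3} (he : ‖e‖ = 1)
    (hF : ∀ v, 0 < F v) {ε R₁ R₂ : ℝ} (hε : 0 < ε)
    (h₁ : ∀ x : Site 3, R₁ ≤ ‖x‖ → F (x + e) / F x ≤ 1 + ε)
    (h₂ : ∀ y : Site 3, R₂ ≤ ‖y‖ → F (y + -e) / F y ≤ 1 + ε) :
    ∀ x : Site 3, max R₁ (R₂ + 1) ≤ ‖x‖ → |F (x + e) / F x - 1| ≤ ε := by
  intro x hx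
  have h1 := h₁ x ((le_max_left _ _).trans hx)
  have hxe : R₂ ≤ ‖x + e‖ := by
    have h := norm_sub_le_norm_add_nsmul he x 1
    rw [one_nsmul, Nat.cast_one] at h
    linarith [(le_max_right _ _).trans hx]
  have h2 := h₂ (x + e) hxe
  rw [add_neg_cancel_right] at h2
  have hq : 0 < F (x + e) / F x := div_pos (hF _) (hF _)
  have hinv : F x / F (x + e) = (F (x + e) / F x)⁻¹ := by rw [inv_div]
  rw [hinv] at h2
  rw [abs_le]
  constructor
  · have h3 : 1 ≤ (1 + ε) * (F (x + e) / F x) := by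
      have := mul_le_mul_of_nonneg_right h2 hq.le
      rwa [inv_mul_cancel₀ hq.ne'] at this
    nlinarith
  · linarith

/-! ### The lower half for `G`: asymptotic log-convexity -/

/-- **Asymptotic log-convexity of `G` in a unit direction `e` forces `G(x+e)/G(x) ≤ 1 + δ`
eventually** (the abstract ray argument with the ceiling `exists_ray_ceiling`). [cite: AizenmanDuminilCopinAnnals2021, Remark 5.10] -/
theorem ratio_le_of_lowerSecondRatio {e : Site 3} (he : ‖e‖ = 1)
    (hS : ∀ η : ℝ, 0 < η → ∃ R : ℝ, ∀ y : Site 3, R ≤ ‖y‖ →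
      (1 - η) * criticalTwoPoint 3 y ^ 2 ≤ criticalTwoPoint 3 (y + e) * criticalTwoPoint 3 (y - e))
    (δ : ℝ) (hδ : 0 < δ) :
    ∃ R : ℝ, ∀ x : Site 3, R ≤ ‖x‖ → criticalTwoPoint 3 (x + e) / criticalTwoPoint 3 x ≤ 1 + δ := by
  obtain ⟨c, hc, hceil⟩ := exists_ray_ceiling
  exact ratio_le_of_lowerSecondRatio_of_ceiling he criticalTwoPoint_pos3 hc
    (fun K hK x => hceil e he K hK x) hS δ hδ

/-- **Asymptotic log-convexity in direction `e` forces two-sided ratio regularity in direction `e`**: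
`|G(x+e)/G(x) - 1| ≤ ε` for `‖x‖ ≥ R(ε)` (the one-sided bound for `e` and for `-e`, the latter read at
the point `x + e`). [cite: AizenmanDuminilCopinAnnals2021, Remark 5.10] -/
theorem ratio_near_one_of_lowerSecondRatio {e : Site 3} (he : ‖e‖ = 1)
    (hS : ∀ η : ℝ, 0 < η → ∃ R : ℝ, ∀ y : Site 3, R ≤ ‖y‖ →
      (1 - η) * criticalTwoPoint 3 y ^ 2 ≤ criticalTwoPoint 3 (y + e) * criticalTwoPoint 3 (y - e))
    (ε : ℝ) (hε : 0 < ε) :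
    ∃ R : ℝ, ∀ x : Site 3, R ≤ ‖x‖ → |criticalTwoPoint 3 (x + e) / criticalTwoPoint 3 x - 1| ≤ ε := by
  have he' : ‖-e‖ = 1 := by rw [norm_neg, he]
  obtain ⟨R₁, hR₁⟩ := ratio_le_of_lowerSecondRatio he hS ε hε
  obtain ⟨R₂, hR₂⟩ := ratio_le_of_lowerSecondRatio he' (lowerSecondRatio_neg hS) ε hε
  exact ⟨max R₁ (R₂ + 1), ratio_near_one_of_two_sides he criticalTwoPoint_pos3 hε hR₁ hR₂⟩

/-- **Asymptotic log-convexity in direction `e₂` forces ratio regularity for every shift `u ∈ ℤ³`.**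
[cite: AizenmanDuminilCopinAnnals2021, Remark 5.10] -/
theorem ratioRegular_of_lowerSecondRatio_e₂
    (hS : ∀ η : ℝ, 0 < η → ∃ R : ℝ, ∀ y : Site 3, R ≤ ‖y‖ →
      (1 - η) * criticalTwoPoint 3 y ^ 2 ≤
        criticalTwoPoint 3 (y + Pi.single 1 1) * criticalTwoPoint 3 (y - Pi.single 1 1))
    (u : Site 3) :
    Tendsto (fun x : Site 3 => criticalTwoPoint 3 (x + u) / criticalTwoPoint 3 x) cofinite (𝓝 1) := by
  have he : ‖(Pi.single 1 1 : Site 3)‖ = 1 := by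
    rw [Pi.norm_single]; simp
  exact ratioRegular_all_of_ratioRegular_e₂
    (tendsto_cofinite_of_radius (ratio_near_one_of_lowerSecondRatio he hS)) u

end Summit.CriticalPhenomena.Ising3DConformalLimit.EnergyNotSigmaSquaredEnergyGapSoft

end
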